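import Mathlib
import Summits.MatrixMultiplication.Statement
import Summits.MatrixMultiplication.MatrixMultiplication.Theorems.GraphEquationsSectionFields
import Summits.MatrixMultiplication.MatrixMultiplication.Theorems.GraphEquationsIsolationLocus
import Summits.MatrixMultiplication.MatrixMultiplication.Theorems.GraphEquationsJetBridge
import Summits.MatrixMultiplication.MatrixMultiplication.Theorems.GraphEquationsJetTruncation

/-!
# Graph equations — the e = 2 rung BY EXACT MEMBERS, unconditionally (M19m)

Closing the loop of NODE-g32 REV 9: square members `⇒ R(⟨n,n,n⟩) ≤ 6·cost` with NO regularity /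
left-inverse / LIFT hypothesis, from the exact-members engine alone:

* `exists_kernel_generic` — a kernel vector of a complex matrix that is non-zero in EVERY coordinate in
  which some kernel vector is non-zero (avoid finitely many hyperplanes along a monomial curve);
* `exists_rowEq_of_forced` — a coordinate FORCED to vanish on the kernel is a row combination
  (`range f^∨ = ann(ker f)`);
* `oscNull_of_rowEq` — the corresponding constant combination of the TESTS equals `f_q` modulo an
  osculation-null remainder (row equation + the coefficient identity on `W`);
* `tensorRank_le_of_sqMembers_at_maxRank` — tests in `I` of nonscalar length `≤ N` whose row matrix has
  maximal rank at the origin, and exact square members `Σ h t = ι(g_q) f_q²`, `g_q(0) ≠ 0` ⇒ `R ≤ 6N`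
  (engine M19k + fields M19l + the three lemmas);
* `EqSystem.Correct.tensorRank_le_of_sq_members_exact` — for a correct system with `f_q² ∈ J_E`:
  `R(⟨n,n,n⟩) ≤ 6·cost(E)` (translate to a max-rank base, which exists by `exists_maxRank_poly`).
  A second, REG-free proof of the consequence of rung `K = 2`.
-/

set_option linter.dupNamespace false

noncomputable section

open scoped BigOperators

namespace Summit.MatrixMultiplication.MatrixMultiplication.Theorems.GraphEquations

open MvPolynomial
open Literature.Computability.AlgebraicComplexity
open Literature.Computability.AlgebraicComplexity.ArithCircuit

variable {n : ℕ}

/-! ## Linear algebra -/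

/-- **Generic kernel vector.**  Some kernel vector of `A` is non-zero in every coordinate in which
SOME kernel vector is non-zero. -/
theorem exists_kernel_generic {T : ℕ} (A : Matrix (Fin T) (Fin n × Fin n) ℂ) :
    ∃ γ : Fin n × Fin n → ℂ, A.mulVec γ = 0 ∧
      ∀ q, (∃ γ' : Fin n × Fin n → ℂ, A.mulVec γ' = 0 ∧ γ' q ≠ 0) → γ q ≠ 0 := by
  classical
  have hw : ∀ q : Fin n × Fin n, ∃ w : Fin n × Fin n → ℂ, A.mulVec w = 0 ∧
      ((∃ γ' : Fin n × Fin n → ℂ, A.mulVec γ' = 0 ∧ γ' q ≠ 0) → w q ≠ 0) := by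
    intro q
    by_cases h : ∃ γ' : Fin n × Fin n → ℂ, A.mulVec γ' = 0 ∧ γ' q ≠ 0
    · obtain ⟨γ', h1, h2⟩ := h
      exact ⟨γ', h1, fun _ => h2⟩
    · exact ⟨0, Matrix.mulVec_zero _, fun h' => absurd h' h⟩
  choose w hwker hwne using hw
  -- distinct exponents
  let e : Fin n × Fin n → ℕ := fun q => (Fintype.equivFin (Fin n × Fin n) q : ℕ)
  have he : Function.Injective e := fun q q' h =>
    (Fintype.equivFin (Fin n × Fin n)).injective (Fin.ext h)
  -- the coordinate polynomials along the monomial curve `s ↦ Σ_q s^{e q} w_q`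
  let p : Fin n × Fin n → Polynomial ℂ := fun q₀ => ∑ q, Polynomial.C (w q q₀) * Polynomial.X ^ e q
  have hp_coeff : ∀ q₀, (p q₀).coeff (e q₀) = w q₀ q₀ := by
    intro q₀
    simp only [p, Polynomial.finsetSum_coeff, Polynomial.coeff_C_mul, Polynomial.coeff_X_pow]
    rw [Finset.sum_eq_single q₀ (fun q _ hq => by rw [if_neg (fun h => hq (he h.symm)), mul_zero])
      (fun h => absurd (Finset.mem_univ q₀) h), if_pos rfl, mul_one]
  have hp_ne : ∀ q₀, (∃ γ' : Fin n × Fin n → ℂ, A.mulVec γ' = 0 ∧ γ' q₀ ≠ 0) → p q₀ ≠ 0 :=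
    fun q₀ h hp0 => hwne q₀ h (by rw [← hp_coeff, hp0, Polynomial.coeff_zero])
  have hp_eval : ∀ q₀ (s : ℂ), (p q₀).eval s = ∑ q, s ^ e q * w q q₀ := by
    intro q₀ s
    simp only [p, Polynomial.eval_finsetSum, Polynomial.eval_mul, Polynomial.eval_C,
      Polynomial.eval_pow, Polynomial.eval_X]
    exact Finset.sum_congr rfl fun q _ => mul_comm _ _
  -- avoid the finitely many bad parameters
  let bad : Finset ℂ := Finset.univ.biUnion fun q₀ => (p q₀).roots.toFinset
  obtain ⟨k, hk⟩ := Infinite.exists_notMem_finset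
    (bad.preimage (Nat.cast : ℕ → ℂ) Nat.cast_injective.injOn)
  set s : ℂ := (k : ℂ) with hs
  have hsbad : s ∉ bad := fun h => hk (Finset.mem_preimage.mpr h)
  refine ⟨fun q' => ∑ q, s ^ e q * w q q', ?_, fun q₀ hq₀ h0 => ?_⟩
  · have hfun : (fun q' => ∑ q, s ^ e q * w q q') = ∑ q, s ^ e q • w q := by
      funext q'
      simp only [Finset.sum_apply, Pi.smul_apply, smul_eq_mul]
    rw [hfun, ← Matrix.mulVecLin_apply, map_sum]
    exact Finset.sum_eq_zero fun q _ => by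
      rw [map_smul, Matrix.mulVecLin_apply, hwker, smul_zero]
  · have h0' : ∑ q, s ^ e q * w q q₀ = 0 := h0
    have hroot : s ∈ (p q₀).roots.toFinset := by
      rw [Multiset.mem_toFinset, Polynomial.mem_roots (hp_ne q₀ hq₀), Polynomial.IsRoot.def,
        hp_eval, h0']
    exact hsbad (Finset.mem_biUnion.mpr ⟨q₀, Finset.mem_univ _, hroot⟩)

/-- **A forced coordinate is a row combination.**  If `γ_q = 0` for every kernel vector `γ` of `A`,
then `e_q = Pᵀ A` for some `P`. -/
theorem exists_rowEq_of_forced {T : ℕ} (A : Matrix (Fin T) (Fin n × Fin n) ℂ) (q : Fin n × Fin n)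
    (hforced : ∀ γ : Fin n × Fin n → ℂ, A.mulVec γ = 0 → γ q = 0) :
    ∃ P : Fin T → ℂ, ∀ q', ∑ o, P o * A o q' = if q = q' then 1 else 0 := by
  classical
  let φ : Module.Dual ℂ (Fin n × Fin n → ℂ) := LinearMap.proj q
  have hφ : φ ∈ (LinearMap.ker (Matrix.mulVecLin A)).dualAnnihilator := by
    rw [Submodule.mem_dualAnnihilator]
    intro w hw
    rw [LinearMap.mem_ker, Matrix.mulVecLin_apply] at hw
    exact hforced w hw
  rw [← LinearMap.range_dualMap_eq_dualAnnihilator_ker] at hφ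
  obtain ⟨ψ, hψ⟩ := hφ
  refine ⟨fun o => ψ (Pi.single o 1), fun q' => ?_⟩
  have h := LinearMap.congr_fun hψ (Pi.single q' 1)
  rw [LinearMap.dualMap_apply, Matrix.mulVecLin_apply] at h
  have hcol : A.mulVec (Pi.single q' 1) = ∑ o, A o q' • (Pi.single o 1 : Fin T → ℂ) := by
    funext o
    simp [Matrix.mulVec, dotProduct, Pi.single_apply, Finset.sum_apply]
  rw [hcol, map_sum] at h
  simp only [map_smul, smul_eq_mul, φ, LinearMap.coe_proj, Function.eval, Pi.single_apply] at h
  rw [← h]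
  exact Finset.sum_congr rfl fun o _ => mul_comm _ _

/-! ## Serving a forced coordinate by the tests -/

/-- **Row equation ⇒ `Σ P_o t_o = f_q` modulo an osculation-null remainder.** -/
theorem oscNull_of_rowEq {T : ℕ} (t : Fin T → MvPolynomial (GraphVars n) ℂ)
    (ht : ∀ o, t o ∈ graphIdeal n) (P : Fin T → ℂ) (q : Fin n × Fin n)
    (hP : ∀ q' : Fin n × Fin n,
      ∑ o, P o * coeff (Finsupp.single (Sum.inr q' : GraphVars n) 1) (t o) = if q = q' then 1 else 0) :
    (∀ q' : Fin n × Fin n, coeff (Finsupp.single (Sum.inr q' : GraphVars n) 1)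
        (∑ o, C (P o) * t o - generator n q) = 0) ∧
      ∀ i j j' l : Fin n,
        coeff (Finsupp.single (Sum.inl (Sum.inl (i, j)) : GraphVars n) 1 +
            Finsupp.single (Sum.inl (Sum.inr (j', l)) : GraphVars n) 1)
          (∑ o, C (P o) * t o - generator n q) = 0 := by
  classical
  refine ⟨fun q' => ?_, fun i j j' l => ?_⟩
  · simp only [coeff_sub, coeff_sum, coeff_C_mul, hP, coeff_inr_generator, sub_self]
  · have hv : ∀ o, coeff (Finsupp.single (Sum.inl (Sum.inl (i, j)) : GraphVars n) 1 +
        Finsupp.single (Sum.inl (Sum.inr (j', l)) : GraphVars n) 1) (t o) =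
          -(if j = j' then coeff (Finsupp.single (Sum.inr (i, l) : GraphVars n) 1) (t o) else 0) :=
      fun o => coeffIdentity n (t o) (fun x hx => eval_eq_zero_of_mem_graphIdeal (ht o) hx) i j j' l
    have hg := coeffIdentity n (generator n q) (fun x hx => eval_generator_of_mem hx q) i j j' l
    simp only [coeff_sub, coeff_sum, coeff_C_mul, hv, hg]
    by_cases hjj : j = j'
    · simp only [hjj, if_true, mul_neg, Finset.sum_neg_distrib, hP, coeff_inr_generator, sub_self]
    · simp only [hjj, if_false, mul_zero, Finset.sum_const_zero, neg_zero, sub_self]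

/-! ## The e = 2 rung at a max-rank base -/

/-- **SQUARE MEMBERS AT A MAX-RANK BASE FORCE THE RANK BOUND — no regularity hypothesis.** -/
theorem tensorRank_le_of_sqMembers_at_maxRank {N T : ℕ} (t : Fin T → MvPolynomial (GraphVars n) ℂ)
    (hspan : ∃ gs : List (MvPolynomial (GraphVars n) ℂ), IsNonscalarSeq gs ∧ gs.length ≤ N ∧
      ∀ o, t o ∈ freeSpan {q | q ∈ gs})
    (ht : ∀ o, t o ∈ graphIdeal n)
    (hmax : ∀ y : MatMulVars n → ℂ,
      (Matrix.of fun o q => eval y (rowPoly (t o) q)).rank ≤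
        (Matrix.of fun o q => eval 0 (rowPoly (t o) q)).rank)
    (hsq : ∀ q : Fin n × Fin n, ∃ (g : MvPolynomial (MatMulVars n) ℂ)
      (h : Fin T → MvPolynomial (GraphVars n) ℂ), coeff 0 g ≠ 0 ∧
        ∑ o, h o * t o = liftAB n g * generator n q ^ 2) :
    tensorRank (matMulTensor ℂ n n n) ≤ 2 * (3 * N) := by
  classical
  set A : Matrix (Fin T) (Fin n × Fin n) ℂ := Matrix.of fun o q => eval 0 (rowPoly (t o) q) with hA
  -- the Jacobian entries at the origin are the linear `c`-coefficients of the tests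
  have hAcoeff : ∀ o q, A o q = coeff (Finsupp.single (Sum.inr q : GraphVars n) 1) (t o) := by
    intro o q
    rw [hA, Matrix.of_apply, MvPolynomial.eval_zero, constantCoeff_eq, coeff_zero_rowPoly]
  -- a generic kernel vector and its V0/V1 affine field
  obtain ⟨γ, hγ, hgen⟩ := exists_kernel_generic A
  obtain ⟨lam, hfree, hval, hV0, hV1⟩ := exists_affField_V01 t hmax γ hγ
  refine tensorRank_le_of_sqMembers_affine t hspan ht (affField γ lam) hfree hV0 hV1 fun q => ?_
  by_cases hq : ∃ γ' : Fin n × Fin n → ℂ, A.mulVec γ' = 0 ∧ γ' q ≠ 0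
  · -- FREE coordinate: the exact square member, differentiated once
    obtain ⟨g, h, hg, hid⟩ := hsq q
    exact Or.inl ⟨by rw [hval]; exact hgen q hq, g, h, hg, hid⟩
  · -- FORCED coordinate: served by the tests
    obtain ⟨P, hP⟩ := exists_rowEq_of_forced A q fun γ' hγ' => by
      by_contra hne
      exact hq ⟨γ', hγ', hne⟩
    have hP' : ∀ q' : Fin n × Fin n,
        ∑ o, P o * coeff (Finsupp.single (Sum.inr q' : GraphVars n) 1) (t o) = if q = q' then 1 else 0 :=
      fun q' => by simpa only [hAcoeff] using hP q'
    obtain ⟨hrc, hrab⟩ := oscNull_of_rowEq t ht P q hP'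
    exact Or.inr ⟨P, ∑ o, C (P o) * t o - generator n q, hrc, hrab, by ring⟩

namespace EqSystem

/-- **THE e = 2 RUNG BY EXACT MEMBERS.**  For a correct system with `f_q² ∈ J_E` for every `q`:
`R(⟨n,n,n⟩) ≤ 6·cost(E)`.  (Translate to a max-rank base — `exists_maxRank_poly` — and apply
`tensorRank_le_of_sqMembers_at_maxRank`; `translate` fixes the `f_q` and preserves cost.) -/
theorem Correct.tensorRank_le_of_sq_members_exact {E : EqSystem n} (hE : E.Correct)
    (hsq : ∀ q, generator n q ^ 2 ∈
      Ideal.span (Set.range fun o : Fin E.tests.length => E.testPoly (E.tests.get o))) :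
    tensorRank (matMulTensor ℂ n n n) ≤ 2 * (3 * E.cost) := by
  classical
  -- a base of maximal rank
  obtain ⟨Δ, hΔ, hΔmax⟩ := exists_maxRank_poly E
  obtain ⟨y, hy⟩ := exists_eval_ne_zero hΔ
  have hmaxy : E.MaxRankAt y := hΔmax y hy
  -- the translated tests
  set t : Fin E.tests.length → MvPolynomial (GraphVars n) ℂ := fun o =>
    GraphEquations.translate y (E.testPoly (E.tests.get o)) with htdef
  obtain ⟨gs, hns, hlen, hfs⟩ := exists_isNonscalarSeq_translate hE.1 y
  have hspan : ∃ gs : List (MvPolynomial (GraphVars n) ℂ), IsNonscalarSeq gs ∧ gs.length ≤ E.cost ∧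
      ∀ o, t o ∈ freeSpan {q | q ∈ gs} := ⟨gs, hns, hlen, hfs⟩
  have ht : ∀ o, t o ∈ graphIdeal n := fun o =>
    translate_mem_graphIdeal y (hE.testPoly_mem_graphIdeal' (List.get_mem E.tests o))
  have hR0 : (Matrix.of fun o q => eval 0 (rowPoly (t o) q)) = E.jacobianC (graphPoint y) := by
    rw [htdef, rowMatrix_translate_eval, zero_add]
  have hmax : ∀ y' : MatMulVars n → ℂ,
      (Matrix.of fun o q => eval y' (rowPoly (t o) q)).rank ≤
        (Matrix.of fun o q => eval 0 (rowPoly (t o) q)).rank := by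
    intro y'
    rw [hR0, htdef, rowMatrix_translate_eval]
    exact hmaxy _
  have hsq' : ∀ q : Fin n × Fin n, ∃ (g : MvPolynomial (MatMulVars n) ℂ)
      (h : Fin E.tests.length → MvPolynomial (GraphVars n) ℂ), coeff 0 g ≠ 0 ∧
        ∑ o, h o * t o = liftAB n g * generator n q ^ 2 := by
    intro q
    obtain ⟨k, hk⟩ := Ideal.mem_span_range_iff_exists_fun.mp (hsq q)
    refine ⟨1, fun o => GraphEquations.translate y (k o), by simp, ?_⟩
    have h := congrArg (GraphEquations.translate y) hk
    have hg := translate_generator y q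
    rw [translate_eq] at hg
    simp only [translate_eq, map_sum, map_mul, map_pow] at h
    rw [hg] at h
    simp only [htdef, translate_eq, map_one, one_mul]
    exact h
  exact tensorRank_le_of_sqMembers_at_maxRank t hspan ht hmax hsq'

end EqSystem

end Summit.MatrixMultiplication.MatrixMultiplication.Theorems.GraphEquations

end
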